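import Literature.Barriers.ValiantsHypothesis.ShiftedPartialsCaseC2

/-!
# Route `PolyaContinued`, crux `MonotoneCoverHard` (stmt-ValiantsHypothesis-7421), line `few-state-cut`:
# cut bookkeeping for the rectangle bound (stub `stub_rectangleBound`) — part 1 of 3

Support file (`--supports stmt-ValiantsHypothesis-7421`) for the registered stub `stub_rectangleBound` of
the line `Cruxes/MonotoneCoverHard/Lines/few_state_cut.lean`.  Pure finite combinatorics, no `Summits`
import, no new definitions; everything is stated with the line's own (inlined) objects:

* a matching of the cover is a permutation `τ : Equiv.Perm (Fin m)` (edges `(i, τ i)`), its LABEL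
  EXPONENT is `∑ i, δ (i, τ i)` for a labelling `δ : Fin m × Fin m → (Fin n × Fin n →₀ ℕ)`;
* the PERMUTATION EXPONENT of `σ : Equiv.Perm (Fin n)` is `∑ k, Finsupp.single (k, σ k) 1` (the exponent
  of the monomial `∏ x_{k σ k}` of `per_n`);
* a vertex cut is `S : Finset (Fin m ⊕ Fin m)` (rows `inl`, columns `inr`); the label exponent splits
  into INSIDE (`inl i ∈ S ∧ inr (τ i) ∈ S`), CROSSING-OUT, CROSSING-IN and OUTSIDE parts, and the
  crossing STATE of `τ` is the image `{(i, τ i) : i crossing}` exactly as in the stub.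

Contents: the numeric inequality `2^(n/3) · k! · (n-k)! ≤ n!` for `n ≤ 3k ≤ 2n`
(`two_pow_mul_factorial_le`, via `2^j ≤ C(n,j)` for `2j ≤ n` and the tree's monotonicity of `C(n,·)`
below the middle, `Literature.Barriers.ValiantsHypothesis.choose_le_choose_of_le_half`); permutation
exponents (`pexp_apply`, `pexp_injective`, rows/degree of a summand of a permutation exponent); the count `#{σ : σ agrees with σ₁ on R} = (n - #R)!` (`card_perm_agree`, via
Mathlib's `Equiv.Perm.subtypeEquivSubtypePerm`); and the cut bookkeeping: four-part decomposition,
the exponent of a MIXED matching (rows inside `S` from `τ`, outside from `τ'`), equality of the crossing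
parts of two matchings with the same state, and the existence of the mixed permutation (`exists_mix`,
the rectangle property of a cut).  Part 2 (`…RectangleCount`) proves the fibre bound and the abstract
`2^(n/3)` bound; part 3 (`…StubRectangleBound`) extracts the label bijection from the polynomial
identity `per_n = aeval a PM_E` and proves the stub verbatim.  Method: Jerrum–Snir / Nisan-type
rectangle counting [folklore].  VP ≠ VNP is not moved by this file (an elementary counting lemma inside an
open crux of a route whose target is summit-strength).
-/

open Finset Equiv

namespace Summit.ValiantsHypothesis.ValiantsHypothesis.Theorems.PolyaContinued.MonotoneCoverHardRectangle

-- summit = sub-problem name (single-conjunct summit, D-0017 layout)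
set_option linter.dupNamespace false

section Numeric
open Nat

/-- `2^j ≤ C(n, j)` whenever `2 j ≤ n`. -/
theorem two_pow_le_choose : ∀ (j n : ℕ), 2 * j ≤ n → 2 ^ j ≤ n.choose j
  | 0, n, _ => by simp
  | j + 1, 0, h => by omega
  | j + 1, n + 1, h => by
    have ih := two_pow_le_choose j n (by omega)
    have key : (n + 1) * n.choose j = (n + 1).choose (j + 1) * (j + 1) :=
      Nat.add_one_mul_choose_eq n j
    have h1 : 2 * (j + 1) * 2 ^ j ≤ (n + 1) * n.choose j :=
      Nat.mul_le_mul (by omega) ih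
    rw [key] at h1
    have h2 : 2 ^ (j + 1) * (j + 1) ≤ (n + 1).choose (j + 1) * (j + 1) := by
      calc 2 ^ (j + 1) * (j + 1) = 2 * (j + 1) * 2 ^ j := by ring
        _ ≤ (n + 1).choose (j + 1) * (j + 1) := h1
    exact Nat.le_of_mul_le_mul_right h2 (by omega)

/-- `2^(n/3) ≤ C(n, k)` for a balanced `k` (`n ≤ 3k ≤ 2n`). -/
theorem two_pow_div_three_le_choose {n k : ℕ} (h1 : n ≤ 3 * k) (h2 : 3 * k ≤ 2 * n) :
    2 ^ (n / 3) ≤ n.choose k := by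
  have hj : 2 ^ (n / 3) ≤ n.choose (n / 3) := two_pow_le_choose _ _ (by omega)
  refine hj.trans ?_
  rcases le_or_gt k (n / 2) with hk | hk
  · exact Literature.Barriers.ValiantsHypothesis.choose_le_choose_of_le_half (by omega) hk
  · rw [← Nat.choose_symm (show k ≤ n by omega)]
    exact Literature.Barriers.ValiantsHypothesis.choose_le_choose_of_le_half (by omega) (by omega)

/-- The factorial form: `2^(n/3) · k! · (n-k)! ≤ n!` for a balanced `k`. -/
theorem two_pow_mul_factorial_le {n k : ℕ} (h1 : n ≤ 3 * k) (h2 : 3 * k ≤ 2 * n) :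
    2 ^ (n / 3) * (k ! * (n - k)!) ≤ n ! := by
  have hk : k ≤ n := by omega
  calc 2 ^ (n / 3) * (k ! * (n - k)!) ≤ n.choose k * (k ! * (n - k)!) :=
        Nat.mul_le_mul_right _ (two_pow_div_three_le_choose h1 h2)
    _ = n ! := by rw [← mul_assoc]; exact Nat.choose_mul_factorial_mul_factorial hk


end Numeric

variable {m n : ℕ}

/-! ### The permutation exponent `∑ k, single (k, σ k) 1` -/

/-- Value of the permutation exponent at `p`. -/
theorem pexp_apply (σ : Perm (Fin n)) (p : Fin n × Fin n) :
    (∑ k, Finsupp.single (k, σ k) (1 : ℕ)) p = if σ p.1 = p.2 then 1 else 0 := by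
  rw [Finsupp.finsetSum_apply, Finset.sum_eq_single p.1]
  · simp only [Finsupp.single_apply, Prod.ext_iff, true_and]
  · intro k _ hk
    simp only [Finsupp.single_apply, Prod.ext_iff]
    rw [if_neg (fun h => hk h.1)]
  · intro h; exact absurd (Finset.mem_univ _) h

/-- The permutation exponent determines the permutation. -/
theorem pexp_injective :
    Function.Injective fun σ : Perm (Fin n) => ∑ k, Finsupp.single (k, σ k) (1 : ℕ) := by
  intro σ σ' h
  refine Equiv.ext fun i => ?_
  have h1 := congrArg (fun u => u (i, σ i)) h
  simp only [pexp_apply, if_true] at h1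
  by_contra hne
  rw [if_neg (Ne.symm hne)] at h1
  exact one_ne_zero h1

/-- If `u + v` is a permutation exponent, the nonzero entries of `v` lie on the graph of `σ`. -/
theorem eq_of_add_eq_pexp {u v : Fin n × Fin n →₀ ℕ} {σ : Perm (Fin n)}
    (h : u + v = ∑ k, Finsupp.single (k, σ k) (1 : ℕ)) {i j : Fin n} (hv : v (i, j) ≠ 0) :
    σ i = j := by
  have h1 := congrArg (fun w => w (i, j)) h
  simp only [Finsupp.add_apply, pexp_apply] at h1
  by_contra hne
  rw [if_neg hne] at h1
  omega

/-- Entries of a summand of a permutation exponent are `≤ 1`. -/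
theorem le_one_of_add_eq_pexp {u v : Fin n × Fin n →₀ ℕ} {σ : Perm (Fin n)}
    (h : u + v = ∑ k, Finsupp.single (k, σ k) (1 : ℕ)) (p : Fin n × Fin n) : v p ≤ 1 := by
  have h1 := congrArg (fun w => w p) h
  simp only [Finsupp.add_apply, pexp_apply] at h1
  split_ifs at h1 <;> omega

/-- The permutation exponent has degree `n`. -/
theorem degree_pexp (σ : Perm (Fin n)) :
    Finsupp.degree (∑ k, Finsupp.single (k, σ k) (1 : ℕ)) = n := by
  simp [map_sum, Finsupp.degree_single]

/-- For a summand `v` of a permutation exponent, the number of rows it touches is its degree. -/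
theorem card_rows_eq_degree {u v : Fin n × Fin n →₀ ℕ} {σ : Perm (Fin n)}
    (h : u + v = ∑ k, Finsupp.single (k, σ k) (1 : ℕ)) :
    (v.support.image Prod.fst).card = Finsupp.degree v := by
  rw [Finset.card_image_of_injOn, Finsupp.degree_apply]
  · symm
    calc ∑ p ∈ v.support, v p = ∑ p ∈ v.support, 1 := by
          refine Finset.sum_congr rfl fun p hp => ?_
          have h1 := le_one_of_add_eq_pexp h p
          have h2 : v p ≠ 0 := Finsupp.mem_support_iff.1 hp
          omega
      _ = v.support.card := by simp
  · intro p hp q hq hpq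
    have hp' : σ p.1 = p.2 := eq_of_add_eq_pexp h (i := p.1) (j := p.2) (Finsupp.mem_support_iff.1 hp)
    have hq' : σ q.1 = q.2 := eq_of_add_eq_pexp h (i := q.1) (j := q.2) (Finsupp.mem_support_iff.1 hq)
    exact Prod.ext hpq (by rw [← hp', ← hq', hpq])

/-- Degrees of the two summands of a permutation exponent add up to `n`. -/
theorem degree_add_eq_of_add_eq_pexp {u v : Fin n × Fin n →₀ ℕ} {σ : Perm (Fin n)}
    (h : u + v = ∑ k, Finsupp.single (k, σ k) (1 : ℕ)) :
    Finsupp.degree u + Finsupp.degree v = n := by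
  rw [← map_add, h, degree_pexp]

/-! ### Permutations agreeing on a set -/

/-- The permutations agreeing with a fixed `σ₁` on a set `R` number `(card α - #R)!`. -/
theorem card_perm_agree {α : Type*} [Fintype α] [DecidableEq α] (σ₁ : Perm α) (R : Finset α)
    [DecidablePred fun σ : Perm α => ∀ i ∈ R, σ i = σ₁ i] :
    (univ.filter fun σ : Perm α => ∀ i ∈ R, σ i = σ₁ i).card =
      (Fintype.card α - R.card).factorial := by
  have e1 : {σ : Perm α // ∀ i ∈ R, σ i = σ₁ i} ≃ {π : Perm α // ∀ a, ¬ (a ∉ R) → π a = a} :=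
    Equiv.subtypeEquiv (Equiv.mulLeft σ₁⁻¹) (by
      intro σ
      simp only [not_not, Equiv.coe_mulLeft, Perm.mul_apply, Perm.inv_def, Equiv.symm_apply_eq])
  have e2 : {π : Perm α // ∀ a, ¬ (a ∉ R) → π a = a} ≃ Perm {a : α // a ∉ R} :=
    (Equiv.Perm.subtypeEquivSubtypePerm (fun a : α => a ∉ R)).symm
  rw [← Fintype.card_subtype, Fintype.card_congr (e1.trans e2), Fintype.card_perm,
    Fintype.card_subtype]
  congr 1
  rw [Finset.filter_not, Finset.filter_mem_eq_inter, Finset.univ_inter, Finset.card_univ_sdiff]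

/-- If `u + v` is the exponent of `σ`, then `σ` agrees with any `σ₁` whose exponent also has
summand `v`... stated as: the exponents `u + v` with `v` fixed come from permutations agreeing
with `σ₁` on the rows of `v`. -/
theorem mem_agree_of_add_eq_pexp {u u₁ v : Fin n × Fin n →₀ ℕ} {σ σ₁ : Perm (Fin n)}
    (h : u + v = ∑ k, Finsupp.single (k, σ k) (1 : ℕ))
    (h₁ : u₁ + v = ∑ k, Finsupp.single (k, σ₁ k) (1 : ℕ)) :
    ∀ i ∈ v.support.image Prod.fst, σ i = σ₁ i := by
  intro i hi
  obtain ⟨p, hp, rfl⟩ := Finset.mem_image.1 hi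
  have hv : v (p.1, p.2) ≠ 0 := Finsupp.mem_support_iff.1 hp
  rw [eq_of_add_eq_pexp h hv, eq_of_add_eq_pexp h₁ hv]


/-! ### Cut bookkeeping: inside / crossing / outside parts of a matching's label exponent -/

section Cut

variable (S : Finset (Fin m ⊕ Fin m)) (δ : Fin m × Fin m → (Fin n × Fin n →₀ ℕ))

/-- Row-split of the label exponent over the rows inside `S`: inside part + crossing-out part. -/
theorem sum_rows_in_eq (τ : Perm (Fin m)) :
    ∑ i ∈ univ.filter (fun i : Fin m => Sum.inl i ∈ S), δ (i, τ i) =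
      ∑ i ∈ univ.filter (fun i : Fin m => Sum.inl i ∈ S ∧ Sum.inr (τ i) ∈ S), δ (i, τ i) +
      ∑ i ∈ univ.filter (fun i : Fin m => Sum.inl i ∈ S ∧ Sum.inr (τ i) ∉ S), δ (i, τ i) := by
  rw [← Finset.sum_filter_add_sum_filter_not (univ.filter fun i : Fin m => Sum.inl i ∈ S)
    (fun i => Sum.inr (τ i) ∈ S), Finset.filter_filter, Finset.filter_filter]

/-- Row-split of the label exponent over the rows outside `S`: crossing-in part + outside part. -/
theorem sum_rows_out_eq (τ : Perm (Fin m)) :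
    ∑ i ∈ univ.filter (fun i : Fin m => Sum.inl i ∉ S), δ (i, τ i) =
      ∑ i ∈ univ.filter (fun i : Fin m => Sum.inl i ∉ S ∧ Sum.inr (τ i) ∈ S), δ (i, τ i) +
      ∑ i ∈ univ.filter (fun i : Fin m => Sum.inl i ∉ S ∧ Sum.inr (τ i) ∉ S), δ (i, τ i) := by
  rw [← Finset.sum_filter_add_sum_filter_not (univ.filter fun i : Fin m => Sum.inl i ∉ S)
    (fun i => Sum.inr (τ i) ∈ S), Finset.filter_filter, Finset.filter_filter]

/-- The full label exponent is the sum of its four parts. -/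
theorem sum_eq_four_parts (τ : Perm (Fin m)) :
    ∑ i, δ (i, τ i) =
      ∑ i ∈ univ.filter (fun i : Fin m => Sum.inl i ∈ S ∧ Sum.inr (τ i) ∈ S), δ (i, τ i) +
      ∑ i ∈ univ.filter (fun i : Fin m => Sum.inl i ∈ S ∧ Sum.inr (τ i) ∉ S), δ (i, τ i) +
      (∑ i ∈ univ.filter (fun i : Fin m => Sum.inl i ∉ S ∧ Sum.inr (τ i) ∈ S), δ (i, τ i) +
      ∑ i ∈ univ.filter (fun i : Fin m => Sum.inl i ∉ S ∧ Sum.inr (τ i) ∉ S), δ (i, τ i)) := by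
  rw [← sum_rows_in_eq, ← sum_rows_out_eq, Finset.sum_filter_add_sum_filter_not]

/-- The label exponent of a MIXED matching (rows inside `S` from `τ`, rows outside `S` from `τ'`). -/
theorem sum_mix_eq (τ τ' μ : Perm (Fin m))
    (hμ : ∀ i, μ i = if Sum.inl i ∈ S then τ i else τ' i) :
    ∑ i, δ (i, μ i) =
      ∑ i ∈ univ.filter (fun i : Fin m => Sum.inl i ∈ S ∧ Sum.inr (τ i) ∈ S), δ (i, τ i) +
      ∑ i ∈ univ.filter (fun i : Fin m => Sum.inl i ∈ S ∧ Sum.inr (τ i) ∉ S), δ (i, τ i) +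
      (∑ i ∈ univ.filter (fun i : Fin m => Sum.inl i ∉ S ∧ Sum.inr (τ' i) ∈ S), δ (i, τ' i) +
      ∑ i ∈ univ.filter (fun i : Fin m => Sum.inl i ∉ S ∧ Sum.inr (τ' i) ∉ S), δ (i, τ' i)) := by
  rw [← sum_rows_in_eq, ← sum_rows_out_eq,
    ← Finset.sum_filter_add_sum_filter_not univ (fun i : Fin m => Sum.inl i ∈ S) (fun i => δ (i, μ i))]
  congr 1
  · refine Finset.sum_congr rfl fun i hi => ?_
    rw [hμ i, if_pos (Finset.mem_filter.1 hi).2]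
  · refine Finset.sum_congr rfl fun i hi => ?_
    rw [hμ i, if_neg (Finset.mem_filter.1 hi).2]

/-- Membership in the crossing-state of a matching. -/
theorem mem_state_iff (τ : Perm (Fin m)) (p : Fin m × Fin m) :
    p ∈ (univ.filter fun i : Fin m =>
        (Sum.inl i ∈ S ∧ Sum.inr (τ i) ∉ S) ∨ (Sum.inl i ∉ S ∧ Sum.inr (τ i) ∈ S)).image
          (fun i => (i, τ i)) ↔
      ((Sum.inl p.1 ∈ S ∧ Sum.inr (τ p.1) ∉ S) ∨ (Sum.inl p.1 ∉ S ∧ Sum.inr (τ p.1) ∈ S)) ∧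
        p.2 = τ p.1 := by
  constructor
  · intro hp
    obtain ⟨i, hi, rfl⟩ := Finset.mem_image.1 hp
    exact ⟨(Finset.mem_filter.1 hi).2, rfl⟩
  · rintro ⟨h1, h2⟩
    exact Finset.mem_image.2 ⟨p.1, Finset.mem_filter.2 ⟨Finset.mem_univ _, h1⟩, Prod.ext rfl h2.symm⟩

/-- Two matchings with the same crossing-state agree on every crossing row. -/
theorem apply_eq_of_state_eq {τ τ' : Perm (Fin m)}
    (h : (univ.filter fun i : Fin m =>
        (Sum.inl i ∈ S ∧ Sum.inr (τ i) ∉ S) ∨ (Sum.inl i ∉ S ∧ Sum.inr (τ i) ∈ S)).image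
          (fun i => (i, τ i)) =
      (univ.filter fun i : Fin m =>
        (Sum.inl i ∈ S ∧ Sum.inr (τ' i) ∉ S) ∨ (Sum.inl i ∉ S ∧ Sum.inr (τ' i) ∈ S)).image
          (fun i => (i, τ' i)))
    (i : Fin m) (hi : (Sum.inl i ∈ S ∧ Sum.inr (τ i) ∉ S) ∨ (Sum.inl i ∉ S ∧ Sum.inr (τ i) ∈ S)) :
    τ' i = τ i := by
  have hp : (i, τ i) ∈ (univ.filter fun i : Fin m =>
        (Sum.inl i ∈ S ∧ Sum.inr (τ i) ∉ S) ∨ (Sum.inl i ∉ S ∧ Sum.inr (τ i) ∈ S)).image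
          (fun i => (i, τ i)) := (mem_state_iff S τ (i, τ i)).2 ⟨hi, rfl⟩
  rw [h, mem_state_iff] at hp
  exact hp.2.symm

/-- Same state ⇒ same crossing-out label part. -/
theorem crossOut_eq_of_state_eq {τ τ' : Perm (Fin m)}
    (h : (univ.filter fun i : Fin m =>
        (Sum.inl i ∈ S ∧ Sum.inr (τ i) ∉ S) ∨ (Sum.inl i ∉ S ∧ Sum.inr (τ i) ∈ S)).image
          (fun i => (i, τ i)) =
      (univ.filter fun i : Fin m =>
        (Sum.inl i ∈ S ∧ Sum.inr (τ' i) ∉ S) ∨ (Sum.inl i ∉ S ∧ Sum.inr (τ' i) ∈ S)).image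
          (fun i => (i, τ' i))) :
    ∑ i ∈ univ.filter (fun i : Fin m => Sum.inl i ∈ S ∧ Sum.inr (τ i) ∉ S), δ (i, τ i) =
      ∑ i ∈ univ.filter (fun i : Fin m => Sum.inl i ∈ S ∧ Sum.inr (τ' i) ∉ S), δ (i, τ' i) := by
  have key : ∀ i : Fin m, Sum.inl i ∈ S → (Sum.inr (τ i) ∉ S ↔ Sum.inr (τ' i) ∉ S) ∧
      (Sum.inr (τ i) ∉ S → τ' i = τ i) := by
    intro i hi
    refine ⟨⟨fun h1 => ?_, fun h1 => ?_⟩, fun h1 => apply_eq_of_state_eq S h i (Or.inl ⟨hi, h1⟩)⟩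
    · rwa [apply_eq_of_state_eq S h i (Or.inl ⟨hi, h1⟩)]
    · rwa [apply_eq_of_state_eq S h.symm i (Or.inl ⟨hi, h1⟩)]
  refine Finset.sum_congr ?_ fun i hi => ?_
  · ext i
    simp only [Finset.mem_filter, Finset.mem_univ, true_and]
    exact ⟨fun ⟨h1, h2⟩ => ⟨h1, (key i h1).1.1 h2⟩, fun ⟨h1, h2⟩ => ⟨h1, (key i h1).1.2 h2⟩⟩
  · obtain ⟨h1, h2⟩ := (Finset.mem_filter.1 hi).2
    rw [(key i h1).2 ((key i h1).1.2 h2)]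

/-- Same state ⇒ same crossing-in label part. -/
theorem crossIn_eq_of_state_eq {τ τ' : Perm (Fin m)}
    (h : (univ.filter fun i : Fin m =>
        (Sum.inl i ∈ S ∧ Sum.inr (τ i) ∉ S) ∨ (Sum.inl i ∉ S ∧ Sum.inr (τ i) ∈ S)).image
          (fun i => (i, τ i)) =
      (univ.filter fun i : Fin m =>
        (Sum.inl i ∈ S ∧ Sum.inr (τ' i) ∉ S) ∨ (Sum.inl i ∉ S ∧ Sum.inr (τ' i) ∈ S)).image
          (fun i => (i, τ' i))) :
    ∑ i ∈ univ.filter (fun i : Fin m => Sum.inl i ∉ S ∧ Sum.inr (τ i) ∈ S), δ (i, τ i) =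
      ∑ i ∈ univ.filter (fun i : Fin m => Sum.inl i ∉ S ∧ Sum.inr (τ' i) ∈ S), δ (i, τ' i) := by
  have key : ∀ i : Fin m, Sum.inl i ∉ S → (Sum.inr (τ i) ∈ S ↔ Sum.inr (τ' i) ∈ S) ∧
      (Sum.inr (τ i) ∈ S → τ' i = τ i) := by
    intro i hi
    refine ⟨⟨fun h1 => ?_, fun h1 => ?_⟩, fun h1 => apply_eq_of_state_eq S h i (Or.inr ⟨hi, h1⟩)⟩
    · rwa [apply_eq_of_state_eq S h i (Or.inr ⟨hi, h1⟩)]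
    · rwa [apply_eq_of_state_eq S h.symm i (Or.inr ⟨hi, h1⟩)]
  refine Finset.sum_congr ?_ fun i hi => ?_
  · ext i
    simp only [Finset.mem_filter, Finset.mem_univ, true_and]
    exact ⟨fun ⟨h1, h2⟩ => ⟨h1, (key i h1).1.1 h2⟩, fun ⟨h1, h2⟩ => ⟨h1, (key i h1).1.2 h2⟩⟩
  · obtain ⟨h1, h2⟩ := (Finset.mem_filter.1 hi).2
    rw [(key i h1).2 ((key i h1).1.2 h2)]

/-- Mixing two matchings with the same crossing-state gives a permutation. -/
theorem exists_mix {τ τ' : Perm (Fin m)}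
    (h : (univ.filter fun i : Fin m =>
        (Sum.inl i ∈ S ∧ Sum.inr (τ i) ∉ S) ∨ (Sum.inl i ∉ S ∧ Sum.inr (τ i) ∈ S)).image
          (fun i => (i, τ i)) =
      (univ.filter fun i : Fin m =>
        (Sum.inl i ∈ S ∧ Sum.inr (τ' i) ∉ S) ∨ (Sum.inl i ∉ S ∧ Sum.inr (τ' i) ∈ S)).image
          (fun i => (i, τ' i))) :
    ∃ μ : Perm (Fin m), ∀ i, μ i = if Sum.inl i ∈ S then τ i else τ' i := by
  have hinj : Function.Injective fun i : Fin m => if Sum.inl i ∈ S then τ i else τ' i := by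
    intro i i' hii'
    simp only at hii'
    by_cases hi : Sum.inl i ∈ S <;> by_cases hi' : Sum.inl i' ∈ S
    · rw [if_pos hi, if_pos hi'] at hii'; exact τ.injective hii'
    · rw [if_pos hi, if_neg hi'] at hii'
      exfalso
      by_cases hc : Sum.inr (τ i) ∈ S
      · -- `i'` is crossing for `τ'` (outside row, inside column), hence `τ i' = τ' i' = τ i`
        have h1 : τ i' = τ' i' :=
          apply_eq_of_state_eq S h.symm i' (Or.inr ⟨hi', by rwa [← hii']⟩)
        exact hi' (by rwa [τ.injective (h1.trans hii'.symm).symm] at hi)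
      · -- `i` is crossing for `τ`, hence `τ' i = τ i = τ' i'`
        have h1 : τ' i = τ i := apply_eq_of_state_eq S h i (Or.inl ⟨hi, hc⟩)
        exact hi' (by rwa [τ'.injective (h1.trans hii')] at hi)
    · rw [if_neg hi, if_pos hi'] at hii'
      exfalso
      by_cases hc : Sum.inr (τ i') ∈ S
      · have h1 : τ i = τ' i :=
          apply_eq_of_state_eq S h.symm i (Or.inr ⟨hi, by rwa [hii']⟩)
        exact hi (by rw [τ.injective (h1.trans hii')]; exact hi')
      · have h1 : τ' i' = τ i' := apply_eq_of_state_eq S h i' (Or.inl ⟨hi', hc⟩)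
        exact hi (by rwa [← τ'.injective (h1.trans hii'.symm)] )
    · rw [if_neg hi, if_neg hi'] at hii'; exact τ'.injective hii'
  exact ⟨Equiv.ofBijective _ (Finite.injective_iff_bijective.1 hinj), fun i => rfl⟩

end Cut

end Summit.ValiantsHypothesis.ValiantsHypothesis.Theorems.PolyaContinued.MonotoneCoverHardRectangle
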